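import Mathlib
import HarnessLib
import Literature.Analysis.FluidPDE.SpaceTimeRescaling
import Summits.NavierStokesRegularity.NavierStokesRegularity.Theorems.QuarterLogPincerThinCascadeDefs

/-!
# Crux `QuarterLogPincer.TypeIQuantSubcubicExp` (stmt-NavierStokesRegularity-24077), line `thin_cascade`:
  the FINAL SLICE of a zoomed cheap cascade — centre value and annular `L³` budgets are scale
  invariant

Helper file (`--supports stmt-NavierStokesRegularity-24077 --as helper`, lead prover ns-tc-p1) toward the
registered stub `stub_thinObjectExtraction` (skeleton `Cruxes/TypeIQuantSubcubicExp/Lines/thin_cascade.lean`),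
complementing `…TypeIQuantSubcubicExpZoomLimit` (the KNSS half).  The zoom of a cheap cascade
`(T, τ, ρ, x₀, u, p)` at its centre and base scale, `w = ρ • stPull (ρ²) ρ T x₀ u`
(`w(s,y) = ρ u(T + ρ²s, x₀ + ρy)`), has at its final slice `s = 0`:

* `zoom_center_value` — `‖w(0,0)‖ = ρ‖u(T,x₀)‖` (so `≥ e^K` for a cascade of length `K`);
* `lintegral_cube_annulus_zoom` — `∫_{a<|y|<b} ‖w(0,y)‖³ dy = ∫_{ρa<|x−x₀|<ρb} ‖u(T,x)‖³ dx` (the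
  `L³` norm is invariant under the Navier–Stokes scaling; change of variables `x = x₀ + ρy`,
  `dx = ρ³dy`, `‖w‖³ = ρ³‖u‖³`; `lintegral` / `ENNReal.ofReal` currency of `CheapCascade`);
* `zoom_annulus_budget` — hence the cascade's final-time annular budgets read
  `∫_{1<|y|<e^j} ‖w(0,y)‖³ ≤ q j` for `1 ≤ j ≤ K`.

These are the inputs of the (open) persistence / trace half of the stub: the centre values force the
singularity of the zoom limit, the budgets pass to the final-time trace by weak lower semicontinuity.

HONEST FRAMING: elementary change of variables; nothing about Navier–Stokes regularity is proved; the
stub, the crux and every summit statement remain open.  No summit statement is proved by this file.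
-/

noncomputable section

-- the summit-side namespace `Summit.NavierStokesRegularity.NavierStokesRegularity.…` (single-conjunct summit,
-- D-0017) repeats a component by design; the dupNamespace linter would flag every declaration.
set_option linter.dupNamespace false

namespace Summit.NavierStokesRegularity.NavierStokesRegularity.Theorems.ThinCascade

open MeasureTheory Set Function Metric Module
open scoped ENNReal
open Literature.Analysis Literature.Analysis.FluidPDE
open Summit.NavierStokesRegularity.NavierStokesRegularity.Cruxes.TypeIQuantSubcubicExp.ThinCascade

/-- Affine substitution in a lower Lebesgue integral over `ℝ³`: `∫ G(c y + v) dy = |c³|⁻¹ ∫ G`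
(`c ≠ 0`; translation invariance and the homothety formula for Lebesgue measure). [folklore] -/
theorem lintegral_comp_smul_add_fin_three (G : EuclideanSpace ℝ (Fin 3) → ℝ≥0∞) {c : ℝ} (hc : c ≠ 0)
    (v : EuclideanSpace ℝ (Fin 3)) :
    ∫⁻ y, G (c • y + v) = ENNReal.ofReal |(c ^ 3)⁻¹| * ∫⁻ x, G x := by
  -- adapted from Literature/Analysis/FluidPDE/PoincareBall.lean (`lintegral_comp_smul_add`)
  have h1 : (fun y => G (c • y + v)) =
      fun y => (fun z => G (c • z)) (y + c⁻¹ • v) := by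
    funext y
    simp only [smul_add, smul_smul, mul_inv_cancel₀ hc, one_smul]
  rw [h1, lintegral_add_right_eq_self (fun z => G (c • z)) (c⁻¹ • v)]
  calc ∫⁻ y, G (c • y)
      = ∫⁻ x, G x ∂(Measure.map (fun y : EuclideanSpace ℝ (Fin 3) => c • y) volume) :=
        (lintegral_map_equiv G
          (Homeomorph.smul (isUnit_iff_ne_zero.2 hc).unit).toMeasurableEquiv).symm
    _ = ENNReal.ofReal |(c ^ 3)⁻¹| * ∫⁻ x, G x := by
        rw [Measure.map_addHaar_smul volume hc, lintegral_smul_measure, smul_eq_mul,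
          finrank_euclideanSpace_fin]

/-- **The centre value of the zoom**: `‖w(0,0)‖ = ρ‖u(T,x₀)‖` for `w = ρ • stPull (ρ²) ρ T x₀ u`,
`ρ ≥ 0`. [folklore] -/
theorem zoom_center_value {ρ : ℝ} (hρ : 0 ≤ ρ) (T : ℝ) (x₀ : EuclideanSpace ℝ (Fin 3))
    (u : ℝ → EuclideanSpace ℝ (Fin 3) → EuclideanSpace ℝ (Fin 3)) :
    ‖(ρ • stPull (ρ ^ 2) ρ T x₀ u) 0 0‖ = ρ * ‖u T x₀‖ := by
  rw [smul_stPull_apply, mul_zero, add_zero, smul_zero, add_zero, norm_smul,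
    Real.norm_of_nonneg hρ]

/-- **Scale invariance of the annular cube**: for `w = ρ • stPull (ρ²) ρ T x₀ u`, `ρ > 0`, and any
`a, b`, `∫_{a<|y|<b} ‖w(0,y)‖³ dy = ∫_{ρa<|x−x₀|<ρb} ‖u(T,x)‖³ dx` (substitution `x = x₀ + ρy`:
`dx = ρ³ dy` cancels `‖ρ u‖³ = ρ³‖u‖³`). [folklore] -/
theorem lintegral_cube_annulus_zoom {ρ : ℝ} (hρ : 0 < ρ) (T : ℝ) (x₀ : EuclideanSpace ℝ (Fin 3))
    (u : ℝ → EuclideanSpace ℝ (Fin 3) → EuclideanSpace ℝ (Fin 3)) (a b : ℝ) :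
    ∫⁻ y in {y : EuclideanSpace ℝ (Fin 3) | a < ‖y‖ ∧ ‖y‖ < b},
        ENNReal.ofReal (‖(ρ • stPull (ρ ^ 2) ρ T x₀ u) 0 y‖ ^ 3) =
      ∫⁻ x in {x : EuclideanSpace ℝ (Fin 3) | ρ * a < ‖x - x₀‖ ∧ ‖x - x₀‖ < ρ * b},
        ENNReal.ofReal (‖u T x‖ ^ 3) := by
  set S : Set (EuclideanSpace ℝ (Fin 3)) := {y | a < ‖y‖ ∧ ‖y‖ < b} with hS
  set S' : Set (EuclideanSpace ℝ (Fin 3)) := {x | ρ * a < ‖x - x₀‖ ∧ ‖x - x₀‖ < ρ * b} with hS'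
  have hd : Measurable fun x : EuclideanSpace ℝ (Fin 3) => ‖x - x₀‖ :=
    (continuous_norm.comp (continuous_sub_right x₀)).measurable
  have hS'm : MeasurableSet S' := by
    rw [hS', setOf_and]
    exact (measurableSet_lt measurable_const hd).inter (measurableSet_lt hd measurable_const)
  have hSm : MeasurableSet S := by
    rw [hS, setOf_and]
    exact (measurableSet_lt measurable_const continuous_norm.measurable).inter
      (measurableSet_lt continuous_norm.measurable measurable_const)
  -- the integrand of the left side is `ρ³ · (indicator of S' applied at x₀ + ρy)`
  set G : EuclideanSpace ℝ (Fin 3) → ℝ≥0∞ := S'.indicator fun x => ENNReal.ofReal (‖u T x‖ ^ 3)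
    with hG
  have hmem : ∀ y, y ∈ S ↔ ρ • y + x₀ ∈ S' := by
    intro y
    simp only [hS, hS', mem_setOf_eq, add_sub_cancel_right, norm_smul, Real.norm_of_nonneg hρ.le]
    constructor
    · rintro ⟨h1, h2⟩; exact ⟨by nlinarith, by nlinarith⟩
    · rintro ⟨h1, h2⟩; exact ⟨by nlinarith, by nlinarith⟩
  have key : ∀ y, S.indicator (fun y => ENNReal.ofReal (‖(ρ • stPull (ρ ^ 2) ρ T x₀ u) 0 y‖ ^ 3)) y =
      ENNReal.ofReal (ρ ^ 3) * G (ρ • y + x₀) := by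
    intro y
    by_cases hy : y ∈ S
    · rw [indicator_of_mem hy, hG, indicator_of_mem ((hmem y).1 hy), smul_stPull_apply, mul_zero,
        add_zero, norm_smul, Real.norm_of_nonneg hρ.le, mul_pow,
        ENNReal.ofReal_mul (by positivity), add_comm x₀]
    · rw [indicator_of_notMem hy, hG, indicator_of_notMem (fun h => hy ((hmem y).2 h)), mul_zero]
  rw [← lintegral_indicator hSm, ← lintegral_indicator hS'm]
  simp_rw [key]
  rw [lintegral_const_mul' _ _ ENNReal.ofReal_ne_top, lintegral_comp_smul_add_fin_three G hρ.ne' x₀,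
    ← mul_assoc, ← ENNReal.ofReal_mul (by positivity)]
  have e : ρ ^ 3 * |(ρ ^ 3)⁻¹| = 1 := by
    rw [abs_of_pos (by positivity)]; field_simp
  rw [e, ENNReal.ofReal_one, one_mul]

/-- **The annular budgets of a zoomed cheap cascade**: if the final slice of `u` has
`∫_{ρ<|x−x₀|<e^jρ} ‖u(T)‖³ ≤ q j` for `1 ≤ j ≤ K`, then the zoom `w = ρ • stPull (ρ²) ρ T x₀ u` has
`∫_{1<|y|<e^j} ‖w(0,y)‖³ ≤ q j` for `1 ≤ j ≤ K`. [folklore] -/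
theorem zoom_annulus_budget {ρ q : ℝ} {K : ℕ} (hρ : 0 < ρ) {T : ℝ} {x₀ : EuclideanSpace ℝ (Fin 3)}
    {u : ℝ → EuclideanSpace ℝ (Fin 3) → EuclideanSpace ℝ (Fin 3)}
    (hbudget : ∀ j : ℕ, 1 ≤ j → j ≤ K →
      ∫⁻ x in {x : EuclideanSpace ℝ (Fin 3) | ρ < ‖x - x₀‖ ∧ ‖x - x₀‖ < Real.exp j * ρ},
          ENNReal.ofReal (‖u T x‖ ^ 3) ≤ ENNReal.ofReal (q * j)) :
    ∀ j : ℕ, 1 ≤ j → j ≤ K →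
      ∫⁻ y in {y : EuclideanSpace ℝ (Fin 3) | 1 < ‖y‖ ∧ ‖y‖ < Real.exp j},
          ENNReal.ofReal (‖(ρ • stPull (ρ ^ 2) ρ T x₀ u) 0 y‖ ^ 3) ≤ ENNReal.ofReal (q * j) := by
  intro j hj1 hjK
  rw [lintegral_cube_annulus_zoom hρ T x₀ u 1 (Real.exp j), mul_one, mul_comm ρ (Real.exp j)]
  exact hbudget j hj1 hjK

/-- **The centre value of a zoomed cheap cascade**: `ρ‖u(T,x₀)‖ ≥ e^K` reads `‖w(0,0)‖ ≥ e^K`.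
[folklore] -/
theorem zoom_center_ge {ρ : ℝ} {K : ℕ} (hρ : 0 < ρ) {T : ℝ} {x₀ : EuclideanSpace ℝ (Fin 3)}
    {u : ℝ → EuclideanSpace ℝ (Fin 3) → EuclideanSpace ℝ (Fin 3)}
    (hcentre : Real.exp K ≤ ρ * ‖u T x₀‖) :
    Real.exp K ≤ ‖(ρ • stPull (ρ ^ 2) ρ T x₀ u) 0 0‖ := by
  rwa [zoom_center_value hρ.le]

end Summit.NavierStokesRegularity.NavierStokesRegularity.Theorems.ThinCascade

end
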